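import Literature.Geometry.Kaehler.ComplexTorusAbelianThreefoldImaginaryQuadraticHodgeEqLefschetz
import Literature.Geometry.Kaehler.ComplexTorusMaximalRealMultiplicationHodgeLieAlgebraDimension
import Literature.Geometry.Kaehler.ComplexTorusHodgeGroupTorusIffCM
import Literature.Geometry.Kaehler.ComplexTorusStablyNondegenerateIffNoTypeIIIAndHodgeEqLefschetz
import Literature.AlgebraicGeometry.ComplexMultiplication.MumfordTateTorusAbelianVarietyRankLowerBounds
import Literature.AlgebraicGeometry.Motives.HodgeTensorFactsHolds
import HarnessLib

/-!
# Moonen–Zarhin 1999 §2 ∕ Thm. (2.5) at `g = 3`: EVERY SIMPLE complex abelian THREEFOLD satisfies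
# `ℬ•(Xⁿ) = 𝒟•(Xⁿ)` for all `n` and `Hg(X) = Lf(X) = S(X)` («`Hg(X) = Sp_D(V,φ)`»), by exhaustion of the four cases
# I(1), I(3), IV(1,1), IV(3,1) of (2.3)

Layer `Literature/Geometry/Kaehler`, namespace `Literature.Geometry.Kaehler.ComplexTorus`; lane `lit-hodgefound`
(Track 2 foundations library), Layer A4, prover seat `lit-hodgefound-p17` (generation 50), self-proposed row g50-#7 —
the ASSEMBLY of MZ99 (2.3) at torus level: Type I(1) (`End⁰(X) = ℚ`, the tree's `ComplexTorusAbelianSurfaceHodgeGeneral`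
§g=3) and Type I(3) (totally real cubic field, g50-#4 `ComplexTorusMaximalRealMultiplicationHodgeLieAlgebraDimension`)
through g50-#4's `IsSimple.forall_divisorClasses_powPeriod_eq_hodgeClasses_of_isTotallyReal_of_finrank_eq_three`; Type
IV(1,1) (imaginary quadratic field) = g50-#6 `ComplexTorusAbelianThreefoldImaginaryQuadraticHodgeEqLefschetz`; Type
IV(3,1) (sextic CM field: `X` is of CM type) = the tree's Ribet–Kubota theorem
`IsAbelianVariety.divisorClasses_powPeriod_eq_hodgeClasses_of_isSimple_of_card_le_six_of_isTorusSubgroup_mumfordTateGroupC`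
(`Literature/AlgebraicGeometry/ComplexMultiplication/MumfordTateTorusAbelianVarietyRankLowerBounds`, «a simple abelian
variety of CM-type of dimension `≤ 3` is stably nondegenerate») with Mumford's criterion
`isTorusSubgroup_mumfordTateGroupC_of_le_endAlgRat` (`ComplexTorusHodgeGroupTorusIffCM`).  The case split is the
tree's `IsSimple.centerField_isTotallyReal_or_isCMField` (the centre of `End⁰(X)` is totally real or CM) with Lange's
table `e·d² ∣ 2g` (`IsSimple.finrank_centerField_mul_finrank_dvd`, `IsSimple.finrank_centerField_endAlgRat_eq_one_of_finrank_eq_three`: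
`d = 1` for threefolds).  THEOREMS ONLY (no definition, no instance, no notation, no named fact; D-0026, net debt 0).

## Sources, VERBATIM (held copies)

* B. J. J. Moonen, Yu. G. Zarhin, *Hodge classes on abelian varieties of low dimension*, Math. Ann. 315 (1999), held
  `paper:arxiv-math_9901113`, §2 (p0005 L12–L18): «We shall give a short overview of the situation for simple complex
  abelian varieties of low dimension. Thus, in this section we shall assume `X` to be simple. For `g := dim(X) ≤ 3`
  and `g = 5` we always find that `Hg(X) = Sp_D(V,φ)`. Since type III does not occur for `g ≤ 3` and `g = 5` (`X`
  simple!), it follows that `ℬ•(Xⁿ) = 𝒟•(Xⁿ)` for all `n`. […] In particular the Hodge conjecture is true for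
  all such `Xⁿ`»; (2.3) `g = 3` (p0005 L83–L106): «There are four cases. Type I(1) […] Type I(3) […] Type IV(1,1)
  […] Type IV(3,1): `End⁰(X) = F` is a CM-field of degree `6` over `ℚ`. Then `Hg(X) = U_F`»; Thm. (2.5) (p0006 L7–L9):
  «Let `X` be a simple complex abelian variety such that `dim(X)` is a prime number. Then `Hg(X) = Sp_D(V,φ)` and
  `ℬ•(Xⁿ) = 𝒟•(Xⁿ)` for every `n ≥ 1`».
* K. A. Ribet, *Division fields of abelian varieties with complex multiplication* (1980), §3 Examples (3.7) («If
  `d = 1, 2, 3` … `(E,S)` is always non-degenerate») — through the tree's theorem above.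
* B. B. Gordon, *A survey of the Hodge conjecture for abelian varieties* (1997∕1999), held `paper:arxiv-alg-geom_9709030`,
  Thm. 6.2 (Ribet's Thm. 0) and Thm. 6.4 (Hazama), Thm. 7.5.
* J. S. Milne, *Lefschetz classes on abelian varieties*, Duke Math. J. 96 (1999), §4 Prop. 4.8, §2 Summary table.
* H. Lange, *Abelian Varieties over the Complex Numbers* (2023), §2.6.1 Proposition (table `d² e ∣ 2g`), §5.5.

## Contents

* §1 (the CM centre) `IsSimple.finrank_centerField_eq_two_or_eq_six_of_finrank_eq_three` (a CM centre of a simple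
  threefold has degree `2` or `6`), **`IsSimple.isTorusSubgroup_mumfordTateGroupC_of_finrank_centerField_eq_six`**
  (`e = 6`: `X` is of CM type, `MT(X)(ℂ)` is a torus), `IsSimple.forall_divisorClasses_powPeriod_eq_hodgeClasses_of_finrank_centerField_eq_six_of_finrank_eq_three`
  (Type IV(3,1) is stably nondegenerate), **`IsSimple.forall_divisorClasses_powPeriod_eq_hodgeClasses_of_isCMField_of_finrank_eq_three`**
  (CM centre: IV(1,1) by g50-#6 or IV(3,1)).
* §2 (every simple threefold) **`IsSimple.forall_divisorClasses_powPeriod_eq_hodgeClasses_of_finrank_eq_three`**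
  (`ℬ•(Xⁿ) = 𝒟•(Xⁿ)` for all `n`), `IsAbelianVariety.forall_divisorClasses_powPeriod_eq_hodgeClasses_of_isSimple_of_finrank_eq_three`
  (polarisation-free form), **`IsSimple.hodgeGroupC_eq_lefschetzIdentityC_of_finrank_eq_three`**,
  `IsSimple.lefschetzIdentityC_eq_lefschetzGroupC_of_finrank_eq_three`, `IsSimple.hodgeGroupC_eq_lefschetzGroupC_of_finrank_eq_three`,
  **`IsSimple.hodgeGroup_eq_lefschetzGroup_of_finrank_eq_three`** («`Hg(X) = Sp_D(V,φ)`» `= S(X)` on real points).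
-/

noncomputable section

open scoped Matrix
open Module Matrix NormedSpace NumberField
open Literature.AlgebraicGeometry.Motives (HodgeTensorFacts hodgeTensorFacts_holds)
open Literature.NumberTheory.Automorphic (IsTorusSubgroup)

namespace Literature.Geometry.Kaehler

namespace ComplexTorus

/-! ## §1 Simple threefolds whose centre is a CM field: Types IV(1,1) and IV(3,1) -/

section CMCentre

variable {κ : Type} [Fintype κ] [DecidableEq κ] [Nonempty κ] {E : Type} [NormedAddCommGroup E] [NormedSpace ℂ E]
  [FiniteDimensional ℂ E] {Ψ : (κ → ℝ) ≃L[ℝ] E} {η : E [⋀^Fin 2]→L[ℝ] ℝ}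

/-- **A CM centre of a simple threefold has degree `2` or `6`** (Lange's table: `e·d² ∣ 2g = 6` with `d = 1` for
threefolds, and `e = [F:ℚ]` is even for a CM field `F`) — Types IV(1,1) and IV(3,1) of MZ99 (2.3).
[cite: MoonenZarhin1999LowDim, §2 (2.3) `g = 3` («Type IV(1,1): `End⁰(X) = F` is an imaginary quadratic field … Type IV(3,1): `End⁰(X) = F` is a CM-field of degree 6»)]
[cite: Lange2023AbelianVarietiesComplex, §2.6.1 Proposition (table, type IV: `e·d² ∣ g`… «restriction»)] -/
theorem IsSimple.finrank_centerField_eq_two_or_eq_six_of_finrank_eq_three (hX : IsSimple Ψ)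
    [IsCMField (centerField Ψ hX)] (h3 : finrank ℂ E = 3) :
    finrank ℚ (centerField Ψ hX) = 2 ∨ finrank ℚ (centerField Ψ hX) = 6 := by
  have hdvd := hX.finrank_centerField_mul_finrank_dvd
  rw [hX.finrank_centerField_endAlgRat_eq_one_of_finrank_eq_three h3, mul_one, h3] at hdvd
  have heven : finrank ℚ (centerField Ψ hX) = 2 * InfinitePlace.nrComplexPlaces (centerField Ψ hX) :=
    IsTotallyComplex.finrank (centerField Ψ hX)
  have hpos : 0 < finrank ℚ (centerField Ψ hX) := finrank_pos
  have hle : finrank ℚ (centerField Ψ hX) ≤ 6 := Nat.le_of_dvd (by norm_num) hdvd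
  interval_cases h : finrank ℚ (centerField Ψ hX) <;> omega

omit [FiniteDimensional ℂ E] in
/-- `End⁰(X)` is commutative when `[End⁰(X) : F] = 1` (`End⁰(X) = F` its centre). [folklore] -/
private theorem endAlgRat_comm_of_finrank_eq_one₅₀₇ (hX : IsSimple Ψ) (h1 : finrank (centerField Ψ hX) (endAlgRat Ψ) = 1) :
    ∀ a ∈ endAlgRat Ψ, ∀ b ∈ endAlgRat Ψ, a * b = b * a := fun a ha b hb ↦ by
  rw [← hX.range_valAlgHom_eq_endAlgRat_of_finrank_eq_one h1] at ha hb
  obtain ⟨x, rfl⟩ := (AlgHom.mem_range _).1 ha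
  obtain ⟨y, rfl⟩ := (AlgHom.mem_range _).1 hb
  rw [← map_mul, ← map_mul, mul_comm]

/-- **TYPE IV(3,1) IS OF CM TYPE: `MT(X)(ℂ)` IS A TORUS** for a simple threefold whose centre has degree `6 = 2g`
(then `End⁰(X) = F` is a commutative field of degree `2g` inside `End⁰(X)`: Mumford's criterion).
[cite: MoonenZarhin1999LowDim, §2 (2.3) `g = 3` («Type IV(3,1) … Then `Hg(X) = U_F`») and Prop. (2.4)(2) («Suppose `X` is of CM-type. Then `Hg(X)` is a `g`-dimensional algebraic torus»)]
[cite: Gordon1997, §2 Prop. 2.12] -/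
theorem IsSimple.isTorusSubgroup_mumfordTateGroupC_of_finrank_centerField_eq_six (hX : IsSimple Ψ)
    (h3 : finrank ℂ E = 3) (he : finrank ℚ (centerField Ψ hX) = 6) : IsTorusSubgroup (mumfordTateGroupC Ψ) := by
  have h1 := hX.finrank_centerField_endAlgRat_eq_one_of_finrank_eq_three h3
  have hfE := hX.range_valAlgHom_eq_endAlgRat_of_finrank_eq_one h1
  set f := centerField.valAlgHom Ψ hX with hf
  haveI : IsReduced ↥f.range :=
    isReduced_of_injective (AlgEquiv.ofInjectiveField f).symm (AlgEquiv.ofInjectiveField f).symm.injective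
  have hcard : Fintype.card κ = 6 := by rw [card_eq_two_mul_finrank Ψ, h3]
  refine isTorusSubgroup_mumfordTateGroupC_of_le_endAlgRat Ψ f.range hfE.le ?_ ?_
  · rintro _ ⟨x, rfl⟩ _ ⟨y, rfl⟩
    rw [← map_mul, ← map_mul, mul_comm]
  · rw [← (AlgEquiv.ofInjectiveField f).toLinearEquiv.finrank_eq, he, hcard]

/-- **TYPE IV(3,1) IS STABLY NONDEGENERATE**: a simple polarised threefold whose centre (`= End⁰(X)`) is a field of
degree `6` satisfies `ℬ•(Xⁿ) = 𝒟•(Xⁿ)` for all `n` — `X` is of CM type (previous theorem) and «a simple abelian variety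
of CM-type of dimension `≤ 3` is non-degenerate» (Ribet (3.7), the tree's
`IsAbelianVariety.divisorClasses_powPeriod_eq_hodgeClasses_of_isSimple_of_card_le_six_of_isTorusSubgroup_mumfordTateGroupC`).
[cite: MoonenZarhin1999LowDim, §2 (p0005 L16–L18: «for `g := dim(X) ≤ 3` … `ℬ•(Xⁿ) = 𝒟•(Xⁿ)` for all `n`»), (2.3) Type IV(3,1), Thm. 0.1 (4)]
[cite: Ribet1980, §3 Examples (3.7) (p. 87)] [cite: Gordon1997, Thm. 6.4 (Hazama) and Thm. 7.5] -/
theorem IsSimple.forall_divisorClasses_powPeriod_eq_hodgeClasses_of_finrank_centerField_eq_six_of_finrank_eq_three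
    (hX : IsSimple Ψ) (hη : IsRiemannForm Ψ η) (h3 : finrank ℂ E = 3) (he : finrank ℚ (centerField Ψ hX) = 6) :
    ∀ k p : ℕ, divisorClasses (powPeriod Ψ k) p = hodgeClasses (powPeriod Ψ k) p := by
  haveI : HodgeTensorFacts.{0, 0} := hodgeTensorFacts_holds.{0, 0}
  have hcard : Fintype.card κ = 6 := by rw [card_eq_two_mul_finrank Ψ, h3]
  have hA : IsAbelianVariety Ψ := ⟨η, hη⟩
  exact fun k p ↦ hA.divisorClasses_powPeriod_eq_hodgeClasses_of_isSimple_of_card_le_six_of_isTorusSubgroup_mumfordTateGroupC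
    hX (hX.isTorusSubgroup_mumfordTateGroupC_of_finrank_centerField_eq_six h3 he) hcard.le k p

/-- **SIMPLE THREEFOLDS WITH CM CENTRE ARE STABLY NONDEGENERATE** — Type IV(1,1) (centre of degree `2` = `End⁰(X)` an
imaginary quadratic field: g50-#6, «`Hg(X) = U_F(V,ψ)`») or Type IV(3,1) (degree `6`, CM type).
[cite: MoonenZarhin1999LowDim, §2 (p0005 L16–L18) and (2.3) `g = 3`, Types IV(1,1), IV(3,1)] [cite: Gordon1997, Thm. 6.2 and Thm. 6.4] -/
theorem IsSimple.forall_divisorClasses_powPeriod_eq_hodgeClasses_of_isCMField_of_finrank_eq_three (hX : IsSimple Ψ)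
    [IsCMField (centerField Ψ hX)] (hη : IsRiemannForm Ψ η) (h3 : finrank ℂ E = 3) :
    ∀ k p : ℕ, divisorClasses (powPeriod Ψ k) p = hodgeClasses (powPeriod Ψ k) p := by
  rcases hX.finrank_centerField_eq_two_or_eq_six_of_finrank_eq_three h3 with he | he
  · exact hX.forall_divisorClasses_powPeriod_eq_hodgeClasses_of_finrank_eq_two_of_finrank_eq_three hη he h3
      (centerField.valAlgHom Ψ hX)
      (hX.range_valAlgHom_eq_endAlgRat_of_finrank_eq_one (hX.finrank_centerField_endAlgRat_eq_one_of_finrank_eq_three h3))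
  · exact hX.forall_divisorClasses_powPeriod_eq_hodgeClasses_of_finrank_centerField_eq_six_of_finrank_eq_three hη h3 he

end CMCentre

/-! ## §2 Every simple complex abelian threefold: `ℬ•(Xⁿ) = 𝒟•(Xⁿ)`, `Hg(X) = Lf(X) = S(X)` -/

section Simple

variable {κ : Type} [Fintype κ] [DecidableEq κ] [Nonempty κ] {E : Type} [NormedAddCommGroup E] [NormedSpace ℂ E]
  [FiniteDimensional ℂ E] {Ψ : (κ → ℝ) ≃L[ℝ] E} {η : E [⋀^Fin 2]→L[ℝ] ℝ}

/-- **MOONEN–ZARHIN 1999 §2 ∕ Thm. (2.5) AT `g = 3`: EVERY SIMPLE polarised complex abelian THREEFOLD is STABLY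
NONDEGENERATE — `ℬ•(Xᵏ) = 𝒟•(Xᵏ)` in every codimension `p` on every power `Xᵏ`** (so the Hodge conjecture holds for
all powers of every simple abelian threefold).  «For `g := dim(X) ≤ 3` […] we always find that `Hg(X) = Sp_D(V,φ)`.
Since type III does not occur for `g ≤ 3` […] (`X` simple!), it follows that `ℬ•(Xⁿ) = 𝒟•(Xⁿ)` for all `n`»; «Let
`X` be a simple complex abelian variety such that `dim(X)` is a prime number. Then `Hg(X) = Sp_D(V,φ)` and
`ℬ•(Xⁿ) = 𝒟•(Xⁿ)` for every `n ≥ 1`» (here the prime `3`).  By exhaustion of (2.3): the centre of `End⁰(X)` is totally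
real (Types I(1), I(3): g50-#4) or CM (Types IV(1,1), IV(3,1): §1).
[cite: MoonenZarhin1999LowDim, §2 (p0005 L12–L18), (2.3) `g = 3` («There are four cases») and Thm. (2.5) (p0006 L7–L9)]
[cite: Gordon1997, Thm. 6.2, Thm. 6.3 with Corollary («simple abelian variety of prime dimension»), Thm. 6.4] -/
theorem IsSimple.forall_divisorClasses_powPeriod_eq_hodgeClasses_of_finrank_eq_three (hX : IsSimple Ψ)
    (hη : IsRiemannForm Ψ η) (h3 : finrank ℂ E = 3) :
    ∀ k p : ℕ, divisorClasses (powPeriod Ψ k) p = hodgeClasses (powPeriod Ψ k) p := by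
  rcases hX.centerField_isTotallyReal_or_isCMField hη with hR | hCM
  · haveI := hR
    exact hX.forall_divisorClasses_powPeriod_eq_hodgeClasses_of_isTotallyReal_of_finrank_eq_three hη h3
  · haveI := hCM
    exact hX.forall_divisorClasses_powPeriod_eq_hodgeClasses_of_isCMField_of_finrank_eq_three hη h3

/-- **Polarisation-free form: every simple complex abelian threefold (`IsAbelianVariety`) satisfies
`ℬ•(Xᵏ) = 𝒟•(Xᵏ)` for all `k, p`.** [cite: MoonenZarhin1999LowDim, §2 (p0005 L12–L18) and Thm. (2.5)] [cite: Gordon1997, Corollary to Thm. 6.3 and Thm. 6.4] -/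
theorem IsAbelianVariety.forall_divisorClasses_powPeriod_eq_hodgeClasses_of_isSimple_of_finrank_eq_three
    (hA : IsAbelianVariety Ψ) (hX : IsSimple Ψ) (h3 : finrank ℂ E = 3) :
    ∀ k p : ℕ, divisorClasses (powPeriod Ψ k) p = hodgeClasses (powPeriod Ψ k) p := by
  obtain ⟨η, hη⟩ := hA
  exact hX.forall_divisorClasses_powPeriod_eq_hodgeClasses_of_finrank_eq_three hη h3

/-- **«`Hg(X) = Sp_D(V,φ)`» FOR EVERY SIMPLE THREEFOLD, complex points: `Hg(X)(ℂ) = Lf(X)(ℂ)`** (the converse half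
of Gordon's Thm. 7.5 ∕ Milne's Prop. 4.8 in the tree: stably nondegenerate ⟹ `S(X)(ℂ)` connected and `Hg = Lf`).
[cite: MoonenZarhin1999LowDim, §2 (p0005 L16–L17) and Thm. (2.5)] [cite: Milne1999LefschetzClasses, §4 Prop. 4.8] [cite: Gordon1997, Thm. 7.5] -/
theorem IsSimple.hodgeGroupC_eq_lefschetzIdentityC_of_finrank_eq_three (hX : IsSimple Ψ) (hη : IsRiemannForm Ψ η)
    {G : Matrix κ κ ℚ} (hG : G.map (Rat.cast : ℚ → ℝ) = latticeGram Ψ η) (h3 : finrank ℂ E = 3) :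
    hodgeGroupC Ψ = lefschetzIdentityC Ψ G :=
  ((hη.forall_divisorClasses_powPeriod_eq_hodgeClasses_iff_eq_and_hodgeGroupC_eq_lefschetzIdentityC hG (by omega)).1
    (hX.forall_divisorClasses_powPeriod_eq_hodgeClasses_of_finrank_eq_three hη h3)).2

/-- **`S(X)(ℂ)` IS CONNECTED for every simple threefold: `Lf(X)(ℂ) = S(X)(ℂ)`** («type III does not occur for
`g ≤ 3`»). [cite: MoonenZarhin1999LowDim, §2 (p0005 L17–L18)] [cite: Milne1999LefschetzClasses, §2 Summary table and §4 Prop. 4.8] -/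
theorem IsSimple.lefschetzIdentityC_eq_lefschetzGroupC_of_finrank_eq_three (hX : IsSimple Ψ) (hη : IsRiemannForm Ψ η)
    {G : Matrix κ κ ℚ} (hG : G.map (Rat.cast : ℚ → ℝ) = latticeGram Ψ η) (h3 : finrank ℂ E = 3) :
    lefschetzIdentityC Ψ G = lefschetzGroupC Ψ G :=
  ((hη.forall_divisorClasses_powPeriod_eq_hodgeClasses_iff_eq_and_hodgeGroupC_eq_lefschetzIdentityC hG (by omega)).1
    (hX.forall_divisorClasses_powPeriod_eq_hodgeClasses_of_finrank_eq_three hη h3)).1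

/-- **`Hg(X)(ℂ) = S(X)(ℂ)`** for every simple threefold (Milne's full centraliser of `End⁰(X)` in `Sp(V,E)`).
[cite: MoonenZarhin1999LowDim, §2 (p0005 L16–L18) and Thm. (2.5)] [cite: Milne1999LefschetzClasses, §4 Prop. 4.8] -/
theorem IsSimple.hodgeGroupC_eq_lefschetzGroupC_of_finrank_eq_three (hX : IsSimple Ψ) (hη : IsRiemannForm Ψ η)
    {G : Matrix κ κ ℚ} (hG : G.map (Rat.cast : ℚ → ℝ) = latticeGram Ψ η) (h3 : finrank ℂ E = 3) :
    hodgeGroupC Ψ = lefschetzGroupC Ψ G := by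
  rw [hX.hodgeGroupC_eq_lefschetzIdentityC_of_finrank_eq_three hη hG h3,
    hX.lefschetzIdentityC_eq_lefschetzGroupC_of_finrank_eq_three hη hG h3]

/-- **«`Hg(X) = Sp_D(V,φ)`» FOR EVERY SIMPLE THREEFOLD, real points: `Hg(X)(ℝ) = S(X)(ℝ)`** (`= lefschetzGroup Ψ η`).
[cite: MoonenZarhin1999LowDim, §2 (p0005 L16–L17) and Thm. (2.5) («Then `Hg(X) = Sp_D(V,φ)`»)] [cite: Milne1999LefschetzClasses, §4 Prop. 4.8] [cite: Gordon1997, Thm. 7.5] -/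
theorem IsSimple.hodgeGroup_eq_lefschetzGroup_of_finrank_eq_three (hX : IsSimple Ψ) (hη : IsRiemannForm Ψ η)
    (h3 : finrank ℂ E = 3) : hodgeGroup Ψ = lefschetzGroup Ψ η := by
  obtain ⟨G, hG⟩ := hη.exists_ratMatrix_latticeGram
  exact ((hη.forall_divisorClasses_powPeriod_eq_hodgeClasses_iff_eq_and_hodgeGroup_eq_lefschetzGroup hG (by omega)).1
    (hX.forall_divisorClasses_powPeriod_eq_hodgeClasses_of_finrank_eq_three hη h3)).2

/-- **The endomorphism algebra of a simple complex abelian threefold is COMMUTATIVE** (a field: `[End⁰(X) : F] = d² = 1`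
by Lange's table — the four cases of (2.3) are all fields), and hence `Hg(X)(ℝ) = Lf(X)(ℝ)` as well.
[cite: MoonenZarhin1999LowDim, §2 (2.3) `g = 3` («There are four cases» — `End⁰(X) = ℚ`, a totally real cubic field, an imaginary quadratic field, a CM-field of degree 6)]
[cite: Lange2023AbelianVarietiesComplex, §2.6.1 Proposition (table `d² e ∣ 2g`)] -/
theorem IsSimple.hodgeGroup_eq_lefschetzIdentity_of_finrank_eq_three (hX : IsSimple Ψ) (hη : IsRiemannForm Ψ η)
    {G : Matrix κ κ ℚ} (hG : G.map (Rat.cast : ℚ → ℝ) = latticeGram Ψ η) (h3 : finrank ℂ E = 3) :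
    hodgeGroup Ψ = lefschetzIdentity Ψ G :=
  (hη.forall_divisorClasses_powPeriod_eq_hodgeClasses_iff_hodgeGroup_eq_lefschetzIdentity_of_endAlgRat_comm hG (by omega)
    (endAlgRat_comm_of_finrank_eq_one₅₀₇ hX (hX.finrank_centerField_endAlgRat_eq_one_of_finrank_eq_three h3))).1
    (hX.forall_divisorClasses_powPeriod_eq_hodgeClasses_of_finrank_eq_three hη h3)

end Simple

end ComplexTorus

end Literature.Geometry.Kaehler
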